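import Mathlib.RingTheory.MvPowerSeries.Substitution
import Mathlib.RingTheory.PowerSeries.Basic
import Mathlib.RingTheory.Polynomial.Cyclotomic.Basic
import Mathlib.NumberTheory.Padics.PadicIntegers
import HarnessLib

/-!
# X11b at `p = 3` (team N8/O2), LINE-W sub-target S16 = LW-L3′ DENSITY LEMMA, part (b): r1's
# COUNTING SIGNATURE OF RECORD (typing only) — torsion slices of `g ∈ ℤ_p⟦X_1,…,X_k⟧`, vanishing at
# torsion points as cyclotomic divisibility, the count `torsionZeroCount`, and the statements
# `TorsionZeroCount` / `TorsionDense` (cell `b2b-bsdres`, team `x11b3`; statement owner r1, typed by p2)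

HONEST FRAMING (verbatim, cell `b2b-bsdres`, run/shared/lean/b2b/bsd-rank1-residual/): the goal of
the cell is to DELETE the COMBINATION-SHAPED residual classes for ALL analytic-rank `≤ 1` curves
over `ℚ` — "full BSD formula for every rank `≤ 1` curve in class `C`" assembled STRICTLY from
published theorems — so that the rank-`≤ 1` remainder becomes exactly the CONSTRUCTION-SHAPED
classes, which are TYPED (missing-input Props), NOT attempted; this is not "finishing BSD".
Research route (team N8/O2: STEP L at `3 ‖ N`, LINE W); PURE ALGEBRA; nothing booked; no label
touched; X11b@3 stays OPEN (RESIDUAL-MAP §I O2). No named fact; no `sorry`.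
DEFINITIONS ONLY (shape predicates, nothing asserted) + one counting lemma; the five definitions and
`torsionDense_of_count` are r1's `HOME/b2b-bsdres-x11b3-r1/LWL3Sig.lean` (sha16 9f39c0ac4120e3b8,
LINE-W v1.9f (i)) VERBATIM. The rung `k = 1` is PROVED in `Three/DensityTorsionCount.lean`
(`Density.torsionZeroCount_one`, `Density.torsionDense_one`); rungs `k = 2, 3` are not in the tree.

HONEST LABEL (verbatim, LEAD DEAL #6 (R6-10)): 'certifies W3-INH's DENSITY step at p = 3 ONLY;
does NOT make MI-W3 available at 3 (tame datum ⊥ B-EW3; (β) vacuous at 3 as printed — kernel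
p252575); LINE W's status string is unchanged by this file'. Moreover (r1 LINE-W v1.9f): the full
statement (b) is a corollary IN PRINT of V. Serban, J. Théor. Nombres Bordeaux 30 (2018) Thm 2.14,
so the kernel certificate is optional bookkeeping, not a missing input.

References: X. Wan, ANT 14 (2020) §5.8 [Wan2020]; V. Serban, *An infinitesimal p-adic multiplicative
Manin–Mumford conjecture*, JTNB 30 (2018) Thm 2.14 [Serban2018]; L. C. Washington, GTM 83, §7.1
[Washington1997]; team files `cells/x11b3/LINE-W.md` v1.9f §LW-L3′, LEAD DEAL #6 (R6-10),
`HOME/b2b-bsdres-x11b3-r1/LWL3Sig.lean` (sha16 9f39c0ac4120e3b8).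
-/

open Polynomial
open scoped PowerSeries

namespace Summit.BirchSwinnertonDyer.Rank1Residual.X11b.Three.Density

/-! ### §0 r1's signature of record (verbatim from `HOME/b2b-bsdres-x11b3-r1/LWL3Sig.lean`) -/

section Signature

variable (p : ℕ) [Fact p.Prime]

/-- The one-variable slice of `g ∈ ℤ_p⟦X_1,…,X_k⟧` along the exponent vector `a`:
`g((1+X)^{a_1} − 1, …, (1+X)^{a_k} − 1) ∈ ℤ_p⟦X⟧` (substitution is legitimate: every
`(1+X)^{a_i} − 1` has zero constant term). (r1, LINE-W §C, signature of record.) [folklore] -/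
noncomputable def torsionSlice {k : ℕ} (a : Fin k → ℕ) (g : MvPowerSeries (Fin k) ℤ_[p]) :
    PowerSeries ℤ_[p] :=
  MvPowerSeries.subst (τ := Unit) (S := ℤ_[p])
    (fun i => (((1 : PowerSeries ℤ_[p]) + PowerSeries.X) ^ (a i) - 1 : PowerSeries ℤ_[p])) g

/-- `g` vanishes at the torsion point `(ζ^{a_1} − 1, …, ζ^{a_k} − 1)` for `ζ` a primitive
`p^t`-th root of unity — equivalently (coefficients in `ℤ_p`, Galois invariance) at all of its
`Gal(ℚ_p(ζ)/ℚ_p)`-conjugates — stated algebraically: `Φ_{p^t}(1+X) ∣ slice_a(g)` in `ℤ_p⟦X⟧`.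
(r1, signature of record.) [folklore] -/
def VanishesAtTorsion {k : ℕ} (t : ℕ) (a : Fin k → ℕ) (g : MvPowerSeries (Fin k) ℤ_[p]) :
    Prop :=
  (((Polynomial.cyclotomic (p ^ t) ℤ_[p]).comp (Polynomial.X + 1) : Polynomial ℤ_[p]) :
      PowerSeries ℤ_[p]) ∣ torsionSlice p a g

/-- The number of torsion points of level `≤ t` (parametrised by exponent vectors
`a ∈ (ℤ/p^t)^k` against ONE primitive `p^t`-th root `ζ`; `a ↦ (ζ^{a_i})_i` is a bijection onto
`μ_{p^t}^k`) at which `g` vanishes. (r1, signature of record.) [folklore] -/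
noncomputable def torsionZeroCount {k : ℕ} (t : ℕ) (g : MvPowerSeries (Fin k) ℤ_[p]) : ℕ :=
  Set.ncard {a : Fin k → Fin (p ^ t) | VanishesAtTorsion p t (fun i => (a i : ℕ)) g}

/-- **LW-L3′ (b)(k)** — codimension-one count of torsion zeros: a non-zero
`g ∈ ℤ_p⟦X_1,…,X_k⟧` vanishes at `O_g(p^{(k−1)t})` of the `p^{kt}` torsion points of level `≤ t`.
(r1, signature of record; shape predicate, nothing asserted.) [folklore] -/
def TorsionZeroCount (k : ℕ) : Prop :=
  ∀ g : MvPowerSeries (Fin k) ℤ_[p], g ≠ 0 →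
    ∃ C : ℕ, ∀ t : ℕ, torsionZeroCount p t g ≤ C * p ^ ((k - 1) * t)

/-- **LW-L3′ (b′)(k)** — the density form the application consumes: a family of sets of torsion
points `S_t ⊆ μ_{p^t}^k` that outgrows every `C·p^{(k−1)t}` is Zariski dense, i.e. only `g = 0`
vanishes on all of them. (r1, signature of record; shape predicate.) [folklore] -/
def TorsionDense (k : ℕ) : Prop :=
  ∀ S : (t : ℕ) → Set (Fin k → Fin (p ^ t)),
    (∀ C : ℕ, ∃ t : ℕ, C * p ^ ((k - 1) * t) < (S t).ncard) →
      ∀ g : MvPowerSeries (Fin k) ℤ_[p],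
        (∀ t, ∀ a ∈ S t, VanishesAtTorsion p t (fun i => (a i : ℕ)) g) → g = 0

/-- (b) ⇒ (b′): pure counting (r1's proof, verbatim). [folklore] -/
theorem torsionDense_of_count (k : ℕ) (h : TorsionZeroCount p k) : TorsionDense p k := by
  intro S hS g hg
  by_contra hne
  obtain ⟨C, hC⟩ := h g hne
  obtain ⟨t, ht⟩ := hS C
  have hsub : S t ⊆ {a : Fin k → Fin (p ^ t) | VanishesAtTorsion p t (fun i => (a i : ℕ)) g} :=
    fun a ha => hg t a ha
  have h1 : (S t).ncard ≤ torsionZeroCount p t g :=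
    Set.ncard_le_ncard hsub (Set.toFinite _)
  exact absurd (lt_of_lt_of_le ht (h1.trans (hC t))) (lt_irrefl _)

end Signature

end Summit.BirchSwinnertonDyer.Rank1Residual.X11b.Three.Density
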